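import Literature.MathematicalPhysics.QuantumFieldTheory.Balaban1983to89.B7Eq123General

/-!
# `Balaban1983to89.B7Eq162General` — T. Bałaban, *Averaging operations for lattice gauge theories*, Commun. Math. Phys.
**98** (1985) 17–51 [Balaban1985Averaging]: Sect. E, the estimates (162), (163) and Proposition 6's bound (164) AT A
GENERAL REGULAR BACKGROUND `U₀`, from (161)

statement-level skeleton of published theorems with citation tags; proofs where landed; nothing here is a claim about the Yang–Mills mass gap

PDF held: `paper:balaban1985-cmp98-averaging` (journal page = PDF page + 16); p. 42 [PDF 26] and p. 43 [PDF 27] read on the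
renders `b2b-balaban-ref1/pages/1985-cmp98-averaging/1985-cmp98-averaging-p026-x2.png`, `-p027-x2.png` (AS IMAGES).

CITATION HEADER / WHAT IS REPRODUCED.  SKELETON row **B7.Eq159** (the estimates (161)–(163) at a GENERAL background; the
identity (159) is `B7Eq92Concrete.avgIter_mul_eq_gaugeAct`, the flat case `B7Prop6Flat`) and the bound (164) of row
**B7.Prop6**; cell `lit-balaban` (HOME `run/shared/lean/pub/lit-balaban/`), seat p06 gen 2 = unit `lit-balaban-p06`.
p. 42, verbatim: *"We will prove that Ū^k = \overline{U′U₀}^k is an analytic function of A′ and Ū^k(Ū₀^k)⁻¹ is close to 1;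
the difference may be estimated by a constant proportional to α₁. We have Ū^k_b(Ū₀^k)_b⁻¹ = (\overline{U′U₀})^k_b(Ū₀^k)_b⁻¹
= (Ũ′)^k_b = v_k(b₋)(U̿′^k)_bR̄^k_{0,b}v_k⁻¹(b₊), b ⊂ Ω^{(k)}, (159) where v_k(x) = (\overline{R̄_{0,x}Ū′})(\overline{R̄_{0,x}
U̿′})·…·(\overline{R̄^{k−1}_{0,x}U̿′^{k−1}}), x ∈ Ω^{(k)}. (160)  From Proposition 4, and especially from (131), we get
|(1/i) log U̿′^j| = |Q_j(U₀, ηA′)| < 2α₁L^jη, (161) hence |(1/i) log(\overline{R̄^j_{0,x}U̿′^j})| = |Σ_{x_j∈B(x)} L^{−d}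
(1/i) log(R̄^j_{0,x}U̿′^j)(Γ_{x,x_j})| < 8α₁dL^{j+1}η e^{2α₁dL^{j+1}η} < O(1)α₁L^{j+1}η, j = 0, 1, …, k−1 (162) and
|v_k(x) − 1| < O(1)α₁ Σ_{j=0}^{k−1} L^{j+1}η ≦ O(1)α₁ (163) for α₁ sufficiently small."*  p. 43: *"**Proposition 6.** If
U₀ satisfies (52), then \overline{U′U₀}^k is an analytic function of A′ = (1/(iη)) log U′ for A′ with values in the
complexified algebra, and satisfying |A′| < α₁. Moreover, we have a bound |\overline{U′U₀}^k(Ū₀^k)⁻¹ − 1| < O(1)α₁. (164)  Of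
course, we assume that α₀, α₁ are sufficiently small."*

CARRIERS (REUSED BY NAME): `B7Eq92Concrete.tHol` ((58) `(R_{0,y}V₁)(Γ)`), `.Fcov` / `.wframe` ((82)/(110), the block frame
`\overline{R_{0,y}V₁} = exp F(y)`), `.dbavgCovIter` ((91) `U̿′^j`), `.vcov` ((97) = (160) `v_j`), `B7Prop2Explicit.avgIter` ((43)
`Ū₀^j`), `B7Prop3Flat.expCfg`, `B7Prop1Explicit.treeWord`/`l1`.  INPUTS BY NAME: (161) at a general background and the
identification `U̿′^j = e^{Q_j}` (`B7Eq123General.prop4_general`, `.dbavgCovIter_eq_expCfg_logCovIter`, `.level_data`); the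
twisted-holonomy bound `B7Prop3GeneralAnalytic.norm_tHol_expCfg_sub_one_le` ((58)/(47)) and `norm_Fcov_le_of_tHol`;
`B7BlockAvgLog.mlog_exp` (`log ∘ exp = id`, the first equality of (162)); (159) `B7Eq92Concrete.val_avgIter_mul_eq`.

WHAT THIS FILE PROVES (kernel, 0 sorry, theorems only; `b` plays `ηα₁` — the lineage reads every level on the unit lattice,
so `Lʲb` plays `α₁Lʲη`).
* §1 one averaging step at an ARBITRARY unit-bounded background `V` for a field `V₁ = e^{A}`, `sup|A_b| ≤ ε`, in terms of
  `u ≥ dLε`, `u ≤ 1/256`: `norm_tHol_treeWord_sub_one_le` (`|(R_{0,y}V₁)(Γ_{y,x}) − 1| ≤ 2u`), **`eq162_oneStep`** (the first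
  equality of (162) `(1/i) log \overline{R_{0,y}V₁} = F(y)` and `|F(y)| ≤ 4u`), `norm_wframe_sub_one_le` (frame and inverse
  frame within `8u` of `1`), `norm_wframe_inv_mul_tHol_sub_one_le` (`|(\overline{R_{0,y}V₁})⁻¹(R_{0,y}V₁)(Γ_{y,x}) − 1| ≤ 11u`).
* §2 THE TOWER at a general regular background (data of `B7Eq123General.prop4_general` + the smallness `2048·d·Lᵏb ≤ 1`,
  print's «for α₁ sufficiently small»): for every level `j < k`, **`eq162_general`** = (162) AS PRINTED
  (`(1/i) log(\overline{R̄^j_{0,x}U̿′^j}) = F_j(x)` and `|·| ≤ 8dL^{j+1}b`, the printed middle bound without its factor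
  `e^{2α₁dL^{j+1}η} ≥ 1`), `norm_twist_general` (`|(R̄^j_{0,x}U̿′^j)(Γ_{x,x_j}) − 1| ≤ 4dL^{j+1}b`), `norm_frame_general` (`≤ 16dL^{j+1}b`,
  frame and inverse), `norm_frameInv_mul_twist_general` (`≤ 22dL^{j+1}b`); for every `j ≤ k`, **`eq163_general`** = (163)
  (`|v_j(x) − 1|, |v_j(x)⁻¹ − 1| ≤ e^{32dLʲb} − 1 ≤ 64dLʲb`); **`eq164_general`** = (164) (`|Ū^k_b(Ū₀^k)_b⁻¹ − 1| ≤ 136(d+1)Lᵏb`).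
DIVERGENCES from print (located): strict `<` ↦ `≤`; constants explicit (print: `O(1)`); the analyticity clause of
Proposition 6 is NOT typed here (its flat case is `B7Prop6Flat.prop6_flat_analyticAt`); global sup bounds on `ℤᵈ`.
-/

noncomputable section

open scoped BigOperators
open NormedSpace Finset

namespace Literature.MathematicalPhysics.QuantumFieldTheory.Balaban1983to89.B7Eq162General

open B7Prop1Explicit B7Prop2Explicit B7Prop3Flat B7Eq92Concrete MatrixLog B7Prop3GeneralAnalytic B7Prop3GeneralLinear
  B7Prop4GeneralLevels B7Eq123General
open B7Prop6Bound (mul_sub_one_norm_le prod_one_add_le_exp_sum geom_tail_le)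

-- `Site` alone would resolve to the torus sites of `Setup.lean`; re-export the `ℤ^d` sites of `B7Prop1Explicit`.
export B7Prop1Explicit (Site)

variable {d : ℕ}
variable {𝔸 : Type*} [NormedRing 𝔸] [NormedAlgebra ℂ 𝔸] [CompleteSpace 𝔸] [NormOneClass 𝔸]

/-! ## §1 One averaging step at an arbitrary unit-bounded background -/

section OneStep

variable {L : ℕ} {V : Site d → Fin d → 𝔸ˣ} {A : Site d → Fin d → 𝔸} {ε u : ℝ}

/-- **the twisted holonomy of `e^{A}` along a tree contour is within `2u` of `1`**: `|A_b| ≤ ε`, `|Γ_{y,x}| ≤ dL`, `dLε ≤ u ≤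
1/64` ⇒ `|(R_{0,y}e^{A})(Γ_{y,x}) − 1| ≤ e^{dLε} − 1 ≤ 2u` ((58); `norm_tHol_expCfg_sub_one_le`).
[cite: Balaban1985Averaging, (58) p.27, (162) p.42] -/
theorem norm_tHol_treeWord_sub_one_le (hV : ∀ x κ, V x κ ∈ U1 𝔸) (hε : 0 ≤ ε) (hA : ∀ x κ, ‖A x κ‖ ≤ ε)
    (hu : ((d * L : ℕ) : ℝ) * ε ≤ u) (hu0 : 0 ≤ u) (hu1 : u ≤ 1 / 64) (y : Site d) {v : Site d} (hv : l1 v ≤ d * L) :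
    ‖((tHol V (expCfg A) y (treeWord v) : 𝔸ˣ) : 𝔸) - 1‖ ≤ 2 * u := by
  refine (norm_tHol_expCfg_sub_one_le hV A hA (treeWord v) y).trans (exp_sub_one_le_of_le ?_ hu0 hu1)
  rw [length_treeWord]
  exact (mul_le_mul_of_nonneg_right (by exact_mod_cast hv) hε).trans hu

/-- **(162), ONE STEP, AT AN ARBITRARY BACKGROUND** — *"|(1/i) log(\overline{R̄_{0,x}U̿′})| = |Σ_{x_j∈B(x)} L^{−d}(1/i)
log(R̄_{0,x}U̿′)(Γ_{x,x_j})| < …"*: for `V` unit-bounded, `V₁ = e^{A}` with `|A_b| ≤ ε`, `dLε ≤ u ≤ 1/256`: the exponent `F(y)` of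
the block frame `\overline{R_{0,y}V₁} = exp F(y)` ((82)/(110)) has `|F(y)| ≤ 4u` (the `L^{−d}`-average of the logarithms (21) of
twisted tree holonomies within `2u` of `1`, `|log X| ≤ 2|X − 1|`), and the FIRST EQUALITY of (162) holds: `log \overline{R_{0,y}V₁}
= F(y)` (`log ∘ exp = id` on `|F| < ln 2`, `B7BlockAvgLog.mlog_exp`). [cite: Balaban1985Averaging, (162) p.42, (82) p.30, (110) p.34] -/
theorem eq162_oneStep (hL : 1 ≤ L) (hV : ∀ x κ, V x κ ∈ U1 𝔸) (hε : 0 ≤ ε) (hA : ∀ x κ, ‖A x κ‖ ≤ ε)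
    (hu : ((d * L : ℕ) : ℝ) * ε ≤ u) (hu0 : 0 ≤ u) (hu1 : u ≤ 1 / 256) (y : Site d) :
    mlog ((wframe L V (expCfg A) y : 𝔸ˣ) : 𝔸) = Fcov L V (expCfg A) y ∧ ‖Fcov L V (expCfg A) y‖ ≤ 4 * u := by
  have hF : ‖Fcov L V (expCfg A) y‖ ≤ 4 * u := by
    have h := norm_Fcov_le_of_tHol hL V (expCfg A) y (τ := 2 * u)
      (fun r => norm_tHol_treeWord_sub_one_le hV hε hA hu hu0 (by linarith) y (l1_boxVec_le L r)) (by linarith)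
    linarith
  refine ⟨?_, hF⟩
  rw [wframe, val_expUnit]
  exact B7BlockAvgLog.mlog_exp (hF.trans_lt (by have := Real.log_two_gt_d9; linarith))

/-- **the block frame and its inverse are within `8u` of `1`**: `|\overline{R_{0,y}V₁} − 1|, |(\overline{R_{0,y}V₁})⁻¹ − 1| ≤
e^{|F(y)|} − 1 ≤ 8u` (the (27)-type step `|e^Z − 1| ≤ e^{|Z|} − 1`). [cite: Balaban1985Averaging, (162)–(163) p.42, (27) p.22] -/
theorem norm_wframe_sub_one_le (hL : 1 ≤ L) (hV : ∀ x κ, V x κ ∈ U1 𝔸) (hε : 0 ≤ ε) (hA : ∀ x κ, ‖A x κ‖ ≤ ε)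
    (hu : ((d * L : ℕ) : ℝ) * ε ≤ u) (hu0 : 0 ≤ u) (hu1 : u ≤ 1 / 256) (y : Site d) :
    ‖((wframe L V (expCfg A) y : 𝔸ˣ) : 𝔸) - 1‖ ≤ 8 * u ∧ ‖(((wframe L V (expCfg A) y)⁻¹ : 𝔸ˣ) : 𝔸) - 1‖ ≤ 8 * u := by
  have hF := (eq162_oneStep hL hV hε hA hu hu0 hu1 y).2
  have h8 : Real.exp (4 * u) - 1 ≤ 8 * u := by
    have := exp_sub_one_le_of_le (le_refl (4 * u)) (by linarith) (by linarith); linarith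
  refine ⟨?_, ?_⟩
  · rw [wframe, val_expUnit]
    exact (norm_exp_sub_one_le_of_norm_le hF).1.trans h8
  · rw [wframe, val_inv_expUnit, val_expUnit]
    exact (norm_exp_sub_one_le_of_norm_le ((norm_neg _).le.trans hF)).1.trans h8

/-- **the level factor of B9 (3.57) / of (159) is within `11u` of `1`**: `|(\overline{R_{0,y}V₁})⁻¹·(R_{0,y}V₁)(Γ_{y,x}) − 1| ≤
(1 + 8u)(1 + 2u) − 1 ≤ 11u` for `x ∈ B(y)` (`|Γ_{y,x}| ≤ dL`). [cite: Balaban1985Averaging, (159)–(162) p.42] -/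
theorem norm_wframe_inv_mul_tHol_sub_one_le (hL : 1 ≤ L) (hV : ∀ x κ, V x κ ∈ U1 𝔸) (hε : 0 ≤ ε)
    (hA : ∀ x κ, ‖A x κ‖ ≤ ε) (hu : ((d * L : ℕ) : ℝ) * ε ≤ u) (hu0 : 0 ≤ u) (hu1 : u ≤ 1 / 256) (y : Site d)
    {v : Site d} (hv : l1 v ≤ d * L) :
    ‖(((wframe L V (expCfg A) y)⁻¹ * tHol V (expCfg A) y (treeWord v) : 𝔸ˣ) : 𝔸) - 1‖ ≤ 11 * u := by
  have h1 := (norm_wframe_sub_one_le hL hV hε hA hu hu0 hu1 y).2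
  have h2 := norm_tHol_treeWord_sub_one_le hV hε hA hu hu0 (by linarith) y hv
  rw [Units.val_mul]
  refine (mul_sub_one_norm_le _ _).trans ?_
  have ha : 0 ≤ ‖(((wframe L V (expCfg A) y)⁻¹ : 𝔸ˣ) : 𝔸) - 1‖ := norm_nonneg _
  have hb : 0 ≤ ‖((tHol V (expCfg A) y (treeWord v) : 𝔸ˣ) : 𝔸) - 1‖ := norm_nonneg _
  nlinarith [mul_le_mul h1 h2 hb (by linarith)]

end OneStep

/-! ## §2 The tower at a general regular background: (162), (163), (164) from (161) -/

section Tower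

variable {L : ℕ} {G : Subgroup 𝔸ˣ} {k : ℕ} {U₀ : Site d → Fin d → 𝔸ˣ} {α₀ : ℝ} {B : Site d → Fin d → 𝔸} {b : ℝ}

/-- the `ℓ¹` length of the offset of a site from the corner of its block is `≤ dL` (each coordinate of `x − L·⌊x/L⌋` lies
in `[0, L)`). [cite: Balaban1985Averaging, (2) p.17, (162) p.42] -/
theorem l1_sub_fl_le (hL : 1 ≤ L) (x : Site d) : l1 (x - (L : ℤ) • B8Ineq130.fl L x) ≤ d * L := by
  have hB := B8Ineq130.inBlock_fl hL x
  unfold l1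
  calc ∑ κ, ((x - (L : ℤ) • B8Ineq130.fl L x) κ).natAbs ≤ ∑ _κ : Fin d, L := by
        refine Finset.sum_le_sum fun κ _ => ?_
        have h := hB κ
        simp only [Pi.sub_apply, Pi.smul_apply, smul_eq_mul] at h ⊢
        omega
    _ = d * L := by rw [Finset.sum_const, Finset.card_univ, Fintype.card_fin, smul_eq_mul]

/-- the per-level smallness: `2048·d·Lᵏb ≤ 1` gives `u_j := 2dL^{j+1}b ≤ 1/256` for `j < k` and `32dLʲb ≤ 1/64` for `j ≤ k`
(print: «for α₁ sufficiently small»). [cite: Balaban1985Averaging, (162)–(163) p.42] -/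
private theorem level_small (hL : 2 ≤ L) (hb : 0 ≤ b) (hsm : 2048 * (d : ℝ) * ((L : ℝ) ^ k * b) ≤ 1) :
    (∀ j < k, 2 * (d : ℝ) * ((L : ℝ) ^ (j + 1) * b) ≤ 1 / 256) ∧
      ∀ j ≤ k, 32 * (d : ℝ) * ((L : ℝ) ^ j * b) ≤ 1 / 64 := by
  have hL1 : (1 : ℝ) ≤ L := by exact_mod_cast le_trans (by norm_num) hL
  have hmono : ∀ j ≤ k, (L : ℝ) ^ j * b ≤ (L : ℝ) ^ k * b := fun j hj =>
    mul_le_mul_of_nonneg_right (pow_le_pow_right₀ hL1 hj) hb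
  have hd : (0 : ℝ) ≤ d := Nat.cast_nonneg d
  refine ⟨fun j hj => ?_, fun j hj => ?_⟩
  · have := mul_le_mul_of_nonneg_left (hmono (j + 1) hj) (by positivity : (0 : ℝ) ≤ 2 * d)
    nlinarith
  · have := mul_le_mul_of_nonneg_left (hmono j hj) (by positivity : (0 : ℝ) ≤ 32 * d)
    nlinarith

/-- `dL·(2Lʲb) = 2dL^{j+1}b` (the `u` of §1 at level `j`, `ε_j = 2Lʲb` being (161)). [cite: Balaban1985Averaging, (161)–(162) p.42] -/
private theorem dL_mul_eps (j : ℕ) : ((d * L : ℕ) : ℝ) * (2 * ((L : ℝ) ^ j * b)) = 2 * (d : ℝ) * ((L : ℝ) ^ (j + 1) * b) := by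
  push_cast; ring

/-- **THE LEVEL DATA BEHIND (162)** (from `B7Eq123General`): under the hypotheses of `prop4_general`, at every level `j ≤ k`
the background `Ū₀ʲ` is unit-bounded, `U̿′ʲ = e^{Q_j}` bondwise and (161) `|Q_j| ≤ 2Lʲb`.
[cite: Balaban1985Averaging, (161) p.42, (127) p.37] -/
theorem level_facts (hL : 2 ≤ L) (hG : AvgClosed d L G) (hU₀ : ∀ x κ, U₀ x κ ∈ G) (hα : 0 < α₀)
    (hα3 : C0 d * α₀ ≤ 1 / 3) (hα4 : 4 * α₀ ≤ c2' d L) (h52 : pdev U₀ < α₀ * (((L : ℝ) ^ k)⁻¹) ^ 2)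
    (hb : 0 ≤ b) (hB : ∀ x κ, ‖B x κ‖ ≤ b)
    (hsmall : Real.exp (4 * (800 * ((d : ℝ) + 1) ^ 2 * ((d : ℝ) + 4)) * α₀)
      * (1 + 8 * (131072 * ((d : ℝ) + 1) ^ 2) * ((L : ℝ) ^ k * b)) ≤ 2)
    (hc₃ : 2 * ((L : ℝ) ^ k * b) ≤ c3 d L) :
    ∀ j ≤ k, (∀ x κ, avgIter L U₀ j x κ ∈ U1 𝔸) ∧
      dbavgCovIter L U₀ (expCfg B) j = expCfg (logCovIter L U₀ B j) ∧
      ∀ z κ, ‖logCovIter L U₀ B j z κ‖ ≤ 2 * ((L : ℝ) ^ j * b) := fun j hj =>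
  ⟨(level_data L hL hG k U₀ hU₀ hα hα3 hα4 h52 j hj).1,
    dbavgCovIter_eq_expCfg_logCovIter L hL hG k U₀ hU₀ hα hα3 hα4 h52 B hb hB hsmall hc₃ j hj,
    (prop4_general L hL hG k U₀ hU₀ hα hα3 hα4 h52 B hb hB hsmall hc₃ j hj).2⟩

/-- **(162) AT A GENERAL REGULAR BACKGROUND, AS PRINTED** — for every level `j < k` and every site `x` of the `(j+1)`-st
lattice (corner `L·x` on the unit lattice of level `j`): the FIRST EQUALITY `(1/i) log(\overline{R̄^j_{0,x}U̿′^j}) = F_j(x)`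
(`= Σ_{x_j∈B(x)} L^{−d}(1/i) log(R̄^j_{0,x}U̿′^j)(Γ_{x,x_j})`, the definition of `B7Eq92Concrete.Fcov`) and the MIDDLE BOUND
`|F_j(x)| ≤ 8dL^{j+1}b` (print: `< 8α₁dL^{j+1}ηe^{2α₁dL^{j+1}η}`, `b = ηα₁`; the factor `e^{…} ≥ 1` is not needed), under the
data of `B7Eq123General.prop4_general` and `2048·d·Lᵏb ≤ 1`. [cite: Balaban1985Averaging, (162) p.42] -/
theorem eq162_general (hL : 2 ≤ L) (hG : AvgClosed d L G) (hU₀ : ∀ x κ, U₀ x κ ∈ G) (hα : 0 < α₀)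
    (hα3 : C0 d * α₀ ≤ 1 / 3) (hα4 : 4 * α₀ ≤ c2' d L) (h52 : pdev U₀ < α₀ * (((L : ℝ) ^ k)⁻¹) ^ 2)
    (hb : 0 ≤ b) (hB : ∀ x κ, ‖B x κ‖ ≤ b)
    (hsmall : Real.exp (4 * (800 * ((d : ℝ) + 1) ^ 2 * ((d : ℝ) + 4)) * α₀)
      * (1 + 8 * (131072 * ((d : ℝ) + 1) ^ 2) * ((L : ℝ) ^ k * b)) ≤ 2)
    (hc₃ : 2 * ((L : ℝ) ^ k * b) ≤ c3 d L) (hsm : 2048 * (d : ℝ) * ((L : ℝ) ^ k * b) ≤ 1)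
    {j : ℕ} (hj : j < k) (y : Site d) :
    mlog ((wframe L (avgIter L U₀ j) (dbavgCovIter L U₀ (expCfg B) j) y : 𝔸ˣ) : 𝔸)
        = Fcov L (avgIter L U₀ j) (dbavgCovIter L U₀ (expCfg B) j) y ∧
      ‖Fcov L (avgIter L U₀ j) (dbavgCovIter L U₀ (expCfg B) j) y‖ ≤ 8 * (d : ℝ) * ((L : ℝ) ^ (j + 1) * b) := by
  have hL1 : 1 ≤ L := le_trans (by norm_num) hL
  obtain ⟨hV, hW, hQ⟩ := level_facts hL hG hU₀ hα hα3 hα4 h52 hb hB hsmall hc₃ j hj.le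
  have hu1 := (level_small hL hb hsm).1 j hj
  rw [hW]
  have h := eq162_oneStep (V := avgIter L U₀ j) (A := logCovIter L U₀ B j) hL1 hV (by positivity) hQ
    (le_of_eq (dL_mul_eps j)) (by positivity) hu1 y
  exact ⟨h.1, h.2.trans (le_of_eq (by ring))⟩

/-- **the twisted transport of (159)/(3.57) at level `j < k` is within `4dL^{j+1}b` of `1`**:
`|(R̄^j_{0,y}U̿′^j)(Γ_{y,x}) − 1| ≤ 4dL^{j+1}b` for every tree contour with `|Γ| ≤ dL` (in particular `x ∈ B(y)`).
[cite: Balaban1985Averaging, (159)–(162) p.42] -/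
theorem norm_twist_general (hL : 2 ≤ L) (hG : AvgClosed d L G) (hU₀ : ∀ x κ, U₀ x κ ∈ G) (hα : 0 < α₀)
    (hα3 : C0 d * α₀ ≤ 1 / 3) (hα4 : 4 * α₀ ≤ c2' d L) (h52 : pdev U₀ < α₀ * (((L : ℝ) ^ k)⁻¹) ^ 2)
    (hb : 0 ≤ b) (hB : ∀ x κ, ‖B x κ‖ ≤ b)
    (hsmall : Real.exp (4 * (800 * ((d : ℝ) + 1) ^ 2 * ((d : ℝ) + 4)) * α₀)
      * (1 + 8 * (131072 * ((d : ℝ) + 1) ^ 2) * ((L : ℝ) ^ k * b)) ≤ 2)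
    (hc₃ : 2 * ((L : ℝ) ^ k * b) ≤ c3 d L) (hsm : 2048 * (d : ℝ) * ((L : ℝ) ^ k * b) ≤ 1)
    {j : ℕ} (hj : j < k) (y : Site d) {v : Site d} (hv : l1 v ≤ d * L) :
    ‖((tHol (avgIter L U₀ j) (dbavgCovIter L U₀ (expCfg B) j) y (treeWord v) : 𝔸ˣ) : 𝔸) - 1‖
      ≤ 4 * (d : ℝ) * ((L : ℝ) ^ (j + 1) * b) := by
  obtain ⟨hV, hW, hQ⟩ := level_facts hL hG hU₀ hα hα3 hα4 h52 hb hB hsmall hc₃ j hj.le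
  have hu1 := (level_small hL hb hsm).1 j hj
  rw [hW]
  have h := norm_tHol_treeWord_sub_one_le (V := avgIter L U₀ j) (A := logCovIter L U₀ B j) hV (by positivity) hQ
    (le_of_eq (dL_mul_eps j)) (by positivity) (by linarith) y hv
  linarith

/-- **the block frames of (160)/(3.57) at level `j < k` and their inverses are within `16dL^{j+1}b` of `1`**.
[cite: Balaban1985Averaging, (160)–(163) p.42] -/
theorem norm_frame_general (hL : 2 ≤ L) (hG : AvgClosed d L G) (hU₀ : ∀ x κ, U₀ x κ ∈ G) (hα : 0 < α₀)
    (hα3 : C0 d * α₀ ≤ 1 / 3) (hα4 : 4 * α₀ ≤ c2' d L) (h52 : pdev U₀ < α₀ * (((L : ℝ) ^ k)⁻¹) ^ 2)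
    (hb : 0 ≤ b) (hB : ∀ x κ, ‖B x κ‖ ≤ b)
    (hsmall : Real.exp (4 * (800 * ((d : ℝ) + 1) ^ 2 * ((d : ℝ) + 4)) * α₀)
      * (1 + 8 * (131072 * ((d : ℝ) + 1) ^ 2) * ((L : ℝ) ^ k * b)) ≤ 2)
    (hc₃ : 2 * ((L : ℝ) ^ k * b) ≤ c3 d L) (hsm : 2048 * (d : ℝ) * ((L : ℝ) ^ k * b) ≤ 1)
    {j : ℕ} (hj : j < k) (y : Site d) :
    ‖((wframe L (avgIter L U₀ j) (dbavgCovIter L U₀ (expCfg B) j) y : 𝔸ˣ) : 𝔸) - 1‖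
        ≤ 16 * (d : ℝ) * ((L : ℝ) ^ (j + 1) * b) ∧
      ‖(((wframe L (avgIter L U₀ j) (dbavgCovIter L U₀ (expCfg B) j) y)⁻¹ : 𝔸ˣ) : 𝔸) - 1‖
        ≤ 16 * (d : ℝ) * ((L : ℝ) ^ (j + 1) * b) := by
  have hL1 : 1 ≤ L := le_trans (by norm_num) hL
  obtain ⟨hV, hW, hQ⟩ := level_facts hL hG hU₀ hα hα3 hα4 h52 hb hB hsmall hc₃ j hj.le
  have hu1 := (level_small hL hb hsm).1 j hj
  rw [hW]
  have h := norm_wframe_sub_one_le (V := avgIter L U₀ j) (A := logCovIter L U₀ B j) hL1 hV (by positivity) hQ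
    (le_of_eq (dL_mul_eps j)) (by positivity) hu1 y
  constructor <;> linarith [h.1, h.2]

/-- **THE PER-LEVEL INPUT OF B9 (3.58)** ([Balaban1985BackgroundPropagators] p. 401): at every level `j < k`, for every site `x`
of the unit lattice with corner `L·x′` (`x′ = ⌊x/L⌋`) of its block, the level factor `(\overline{R̄^j_{0,Lx′}U̿′^j})⁻¹
(R̄^j_{0,Lx′}U̿′^j)(Γ_{Lx′,x})` of B9 (3.57) is within `22dL^{j+1}b` of `1` — the shape `O(1)α₁L^{j+1}ξ` of (162).
[cite: Balaban1985Averaging, (159)–(162) p.42] -/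
theorem norm_frameInv_mul_twist_general (hL : 2 ≤ L) (hG : AvgClosed d L G) (hU₀ : ∀ x κ, U₀ x κ ∈ G) (hα : 0 < α₀)
    (hα3 : C0 d * α₀ ≤ 1 / 3) (hα4 : 4 * α₀ ≤ c2' d L) (h52 : pdev U₀ < α₀ * (((L : ℝ) ^ k)⁻¹) ^ 2)
    (hb : 0 ≤ b) (hB : ∀ x κ, ‖B x κ‖ ≤ b)
    (hsmall : Real.exp (4 * (800 * ((d : ℝ) + 1) ^ 2 * ((d : ℝ) + 4)) * α₀)
      * (1 + 8 * (131072 * ((d : ℝ) + 1) ^ 2) * ((L : ℝ) ^ k * b)) ≤ 2)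
    (hc₃ : 2 * ((L : ℝ) ^ k * b) ≤ c3 d L) (hsm : 2048 * (d : ℝ) * ((L : ℝ) ^ k * b) ≤ 1)
    {j : ℕ} (hj : j < k) (y : Site d) {v : Site d} (hv : l1 v ≤ d * L) :
    ‖((((wframe L (avgIter L U₀ j) (dbavgCovIter L U₀ (expCfg B) j) y)⁻¹
        * tHol (avgIter L U₀ j) (dbavgCovIter L U₀ (expCfg B) j) y (treeWord v) : 𝔸ˣ) : 𝔸)) - 1‖
      ≤ 22 * (d : ℝ) * ((L : ℝ) ^ (j + 1) * b) := by
  have hL1 : 1 ≤ L := le_trans (by norm_num) hL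
  obtain ⟨hV, hW, hQ⟩ := level_facts hL hG hU₀ hα hα3 hα4 h52 hb hB hsmall hc₃ j hj.le
  have hu1 := (level_small hL hb hsm).1 j hj
  rw [hW]
  have h := norm_wframe_inv_mul_tHol_sub_one_le (V := avgIter L U₀ j) (A := logCovIter L U₀ B j) hL1 hV (by positivity)
    hQ (le_of_eq (dL_mul_eps j)) (by positivity) hu1 y hv
  linarith

omit [NormOneClass 𝔸] in
/-- (160) multiplied out: if every factor `\overline{R̄^l_{0,·}U̿′^l}`, `l < j`, and its inverse are within `φ_l ≥ 0` of `1`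
uniformly in the site, then `|v_j(x) − 1|, |v_j(x)⁻¹ − 1| ≤ Π_{l<j}(1 + φ_l) − 1` (`vcov_succ` + `|ab − 1| ≤ (1+|a−1|)(1+|b−1|)
− 1`). [cite: Balaban1985Averaging, (160) p.42, (163) p.42] -/
theorem norm_vcov_sub_one_le_prod (L : ℕ) (U₀ U₁ : Site d → Fin d → 𝔸ˣ) {φ : ℕ → ℝ} (hφ0 : ∀ l, 0 ≤ φ l) :
    ∀ (j : ℕ), (∀ l < j, ∀ s : Site d,
        ‖((wframe L (avgIter L U₀ l) (dbavgCovIter L U₀ U₁ l) s : 𝔸ˣ) : 𝔸) - 1‖ ≤ φ l ∧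
        ‖(((wframe L (avgIter L U₀ l) (dbavgCovIter L U₀ U₁ l) s)⁻¹ : 𝔸ˣ) : 𝔸) - 1‖ ≤ φ l) →
      ∀ y : Site d, ‖((vcov L U₀ U₁ j y : 𝔸ˣ) : 𝔸) - 1‖ ≤ (∏ l ∈ range j, (1 + φ l)) - 1 ∧
        ‖(((vcov L U₀ U₁ j y)⁻¹ : 𝔸ˣ) : 𝔸) - 1‖ ≤ (∏ l ∈ range j, (1 + φ l)) - 1
  | 0, _, y => by simp
  | j + 1, hfr, y => by
      have ih := norm_vcov_sub_one_le_prod L U₀ U₁ hφ0 j (fun l hl s => hfr l (Nat.lt_succ_of_lt hl) s) ((L : ℤ) • y)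
      have hj := hfr j (Nat.lt_succ_self j) ((L : ℤ) • y)
      have hP : 0 ≤ ∏ l ∈ range j, (1 + φ l) := Finset.prod_nonneg fun l _ => by linarith [hφ0 l]
      rw [vcov_succ, Finset.prod_range_succ]
      constructor
      · rw [Units.val_mul]
        refine (mul_sub_one_norm_le _ _).trans ?_
        have h1 : 1 + ‖((vcov L U₀ U₁ j ((L : ℤ) • y) : 𝔸ˣ) : 𝔸) - 1‖ ≤ ∏ l ∈ range j, (1 + φ l) := by linarith [ih.1]
        have h2 : 1 + ‖((wframe L (avgIter L U₀ j) (dbavgCovIter L U₀ U₁ j) ((L : ℤ) • y) : 𝔸ˣ) : 𝔸) - 1‖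
            ≤ 1 + φ j := by linarith [hj.1]
        nlinarith [mul_le_mul h1 h2 (by positivity) hP]
      · rw [mul_inv_rev, Units.val_mul]
        refine (mul_sub_one_norm_le _ _).trans ?_
        have h1 : 1 + ‖(((vcov L U₀ U₁ j ((L : ℤ) • y))⁻¹ : 𝔸ˣ) : 𝔸) - 1‖ ≤ ∏ l ∈ range j, (1 + φ l) := by
          linarith [ih.2]
        have h2 : 1 + ‖(((wframe L (avgIter L U₀ j) (dbavgCovIter L U₀ U₁ j) ((L : ℤ) • y))⁻¹ : 𝔸ˣ) : 𝔸) - 1‖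
            ≤ 1 + φ j := by linarith [hj.2]
        nlinarith [mul_le_mul h2 h1 (by positivity) (by linarith [hφ0 j])]

/-- **(163) AT A GENERAL REGULAR BACKGROUND** — *"|v_k(x) − 1| < O(1)α₁ Σ_{j=0}^{k−1} L^{j+1}η ≦ O(1)α₁ (163) for α₁
sufficiently small"*: under the data of `B7Eq123General.prop4_general` and `2048·d·Lᵏb ≤ 1`, for every `j ≤ k` and every site
of the `j`-th lattice, `|v_j(x) − 1|` and `|v_j(x)⁻¹ − 1|` are `≤ e^{32dLʲb} − 1 ≤ 64dLʲb` (the frames within `16dL^{l+1}b` of `1`,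
`Σ_{l<j}L^{l+1} ≤ 2Lʲ` for `L ≥ 2`). [cite: Balaban1985Averaging, (163) p.42] -/
theorem eq163_general (hL : 2 ≤ L) (hG : AvgClosed d L G) (hU₀ : ∀ x κ, U₀ x κ ∈ G) (hα : 0 < α₀)
    (hα3 : C0 d * α₀ ≤ 1 / 3) (hα4 : 4 * α₀ ≤ c2' d L) (h52 : pdev U₀ < α₀ * (((L : ℝ) ^ k)⁻¹) ^ 2)
    (hb : 0 ≤ b) (hB : ∀ x κ, ‖B x κ‖ ≤ b)
    (hsmall : Real.exp (4 * (800 * ((d : ℝ) + 1) ^ 2 * ((d : ℝ) + 4)) * α₀)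
      * (1 + 8 * (131072 * ((d : ℝ) + 1) ^ 2) * ((L : ℝ) ^ k * b)) ≤ 2)
    (hc₃ : 2 * ((L : ℝ) ^ k * b) ≤ c3 d L) (hsm : 2048 * (d : ℝ) * ((L : ℝ) ^ k * b) ≤ 1)
    {j : ℕ} (hj : j ≤ k) (y : Site d) :
    (‖((vcov L U₀ (expCfg B) j y : 𝔸ˣ) : 𝔸) - 1‖ ≤ Real.exp (32 * (d : ℝ) * ((L : ℝ) ^ j * b)) - 1 ∧
      ‖(((vcov L U₀ (expCfg B) j y)⁻¹ : 𝔸ˣ) : 𝔸) - 1‖ ≤ Real.exp (32 * (d : ℝ) * ((L : ℝ) ^ j * b)) - 1) ∧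
      Real.exp (32 * (d : ℝ) * ((L : ℝ) ^ j * b)) - 1 ≤ 64 * (d : ℝ) * ((L : ℝ) ^ j * b) := by
  have hLr : (2 : ℝ) ≤ L := by exact_mod_cast hL
  have hd : (0 : ℝ) ≤ d := Nat.cast_nonneg d
  -- the per-level frame bounds in the shape `φ_l = 16d·L^{l+1}b`
  set φ : ℕ → ℝ := fun l => 16 * (d : ℝ) * ((L : ℝ) ^ (l + 1) * b) with hφ
  have hφ0 : ∀ l, 0 ≤ φ l := fun l => by positivity
  have hfr : ∀ l < j, ∀ s : Site d,
      ‖((wframe L (avgIter L U₀ l) (dbavgCovIter L U₀ (expCfg B) l) s : 𝔸ˣ) : 𝔸) - 1‖ ≤ φ l ∧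
      ‖(((wframe L (avgIter L U₀ l) (dbavgCovIter L U₀ (expCfg B) l) s)⁻¹ : 𝔸ˣ) : 𝔸) - 1‖ ≤ φ l :=
    fun l hl s => norm_frame_general hL hG hU₀ hα hα3 hα4 h52 hb hB hsmall hc₃ hsm (lt_of_lt_of_le hl hj) s
  have hv := norm_vcov_sub_one_le_prod L U₀ (expCfg B) hφ0 j hfr y
  -- `Π(1 + φ_l) ≤ exp(Σφ_l) ≤ exp(32dLʲb)`
  have hsum : ∑ l ∈ range j, φ l ≤ 32 * (d : ℝ) * ((L : ℝ) ^ j * b) := by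
    have hgeom := geom_tail_le (L : ℝ) hLr j
    have hLj : (0 : ℝ) < (L : ℝ) ^ j := by positivity
    have hterm : ∀ l ∈ range j, φ l = (16 * (d : ℝ) * ((L : ℝ) ^ j * b)) * ((L : ℝ) ^ (l + 1) / (L : ℝ) ^ j) := by
      intro l _; rw [hφ]; field_simp
    rw [Finset.sum_congr rfl hterm, ← Finset.mul_sum]
    have h0 : 0 ≤ 16 * (d : ℝ) * ((L : ℝ) ^ j * b) := by positivity
    nlinarith [mul_le_mul_of_nonneg_left hgeom h0]
  have hprod : (∏ l ∈ range j, (1 + φ l)) - 1 ≤ Real.exp (32 * (d : ℝ) * ((L : ℝ) ^ j * b)) - 1 := by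
    linarith [(prod_one_add_le_exp_sum φ j hφ0).trans (Real.exp_le_exp.2 hsum)]
  have h64 : Real.exp (32 * (d : ℝ) * ((L : ℝ) ^ j * b)) - 1 ≤ 64 * (d : ℝ) * ((L : ℝ) ^ j * b) := by
    have hs := (level_small hL hb hsm).2 j hj
    have := exp_sub_one_le_of_le (le_refl (32 * (d : ℝ) * ((L : ℝ) ^ j * b))) (by positivity) hs
    linarith
  exact ⟨⟨hv.1.trans hprod, hv.2.trans hprod⟩, h64⟩

/-- **PROPOSITION 6, THE BOUND (164) AT A GENERAL REGULAR BACKGROUND** — *"|\overline{U′U₀}^k(Ū₀^k)⁻¹ − 1| < O(1)α₁.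
(164)"*: under the data of `B7Eq123General.prop4_general` (`U′ = e^{B}`, `sup|B| ≤ b` playing `ηα₁`) and `2048·d·Lᵏb ≤ 1`,
at every bond of the `k`-th lattice `|Ū^k_b(Ū₀^k)_b⁻¹ − 1| ≤ 136(d+1)·Lᵏb` — by (159) `Ū^k_b(Ū₀^k)_b⁻¹ =
v_k(b₋)(U̿′^k)_b R̄^k_{0,b}v_k⁻¹(b₊)` (`B7Eq92Concrete.val_avgIter_mul_eq`) with (161) for `U̿′^k`, (163) for `v_k`, and
`|R(u)X − 1| ≤ |X − 1|` for the unit-bounded `u = (Ū₀^k)_b`. [cite: Balaban1985Averaging, Proposition 6 (164) p.43, (159) p.42] -/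
theorem eq164_general (hL : 2 ≤ L) (hG : AvgClosed d L G) (hU₀ : ∀ x κ, U₀ x κ ∈ G) (hα : 0 < α₀)
    (hα3 : C0 d * α₀ ≤ 1 / 3) (hα4 : 4 * α₀ ≤ c2' d L) (h52 : pdev U₀ < α₀ * (((L : ℝ) ^ k)⁻¹) ^ 2)
    (hb : 0 ≤ b) (hB : ∀ x κ, ‖B x κ‖ ≤ b)
    (hsmall : Real.exp (4 * (800 * ((d : ℝ) + 1) ^ 2 * ((d : ℝ) + 4)) * α₀)
      * (1 + 8 * (131072 * ((d : ℝ) + 1) ^ 2) * ((L : ℝ) ^ k * b)) ≤ 2)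
    (hc₃ : 2 * ((L : ℝ) ^ k * b) ≤ c3 d L) (hsm : 2048 * (d : ℝ) * ((L : ℝ) ^ k * b) ≤ 1)
    (h1 : 128 * ((L : ℝ) ^ k * b) ≤ 1) (z : Site d) (κ : Fin d) :
    ‖((avgIter L (expCfg B * U₀) k z κ : 𝔸ˣ) : 𝔸) * (((avgIter L U₀ k z κ)⁻¹ : 𝔸ˣ) : 𝔸) - 1‖
      ≤ 136 * ((d : ℝ) + 1) * ((L : ℝ) ^ k * b) := by
  obtain ⟨hV, hW, hQ⟩ := level_facts hL hG hU₀ hα hα3 hα4 h52 hb hB hsmall hc₃ k le_rfl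
  obtain ⟨⟨hv, -⟩, h64⟩ := eq163_general hL hG hU₀ hα hα3 hα4 h52 hb hB hsmall hc₃ hsm le_rfl z
  obtain ⟨⟨-, hv'⟩, -⟩ := eq163_general hL hG hU₀ hα hα3 hα4 h52 hb hB hsmall hc₃ hsm le_rfl (z + e κ)
  set x : ℝ := (L : ℝ) ^ k * b with hx
  have hx0 : 0 ≤ x := by positivity
  have hd : (0 : ℝ) ≤ d := Nat.cast_nonneg d
  -- the middle factor `(U̿′^k)_b = e^{Q_k(b)}` within `e^{2x} − 1 ≤ 4x` of `1`
  have hWb : ‖((dbavgCovIter L U₀ (expCfg B) k z κ : 𝔸ˣ) : 𝔸) - 1‖ ≤ 4 * x := by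
    rw [hW]
    simp only [expCfg, val_expUnit]
    have h := (norm_exp_sub_one_le_of_norm_le (hQ z κ)).1
    have : Real.exp (2 * x) - 1 ≤ 4 * x := by
      have := exp_sub_one_le_of_le (le_refl (2 * x)) (by positivity) (by linarith); linarith
    exact h.trans this
  -- (159): `Ū^k(b)(Ū₀^k(b))⁻¹ = v_k(b₋)·U̿′^k(b)·[Ū₀^k(b) v_k(b₊)⁻¹ Ū₀^k(b)⁻¹]`
  have h159 : ((avgIter L (expCfg B * U₀) k z κ : 𝔸ˣ) : 𝔸) * (((avgIter L U₀ k z κ)⁻¹ : 𝔸ˣ) : 𝔸)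
      = ((vcov L U₀ (expCfg B) k z : 𝔸ˣ) : 𝔸) * ((dbavgCovIter L U₀ (expCfg B) k z κ : 𝔸ˣ) : 𝔸)
        * (((avgIter L U₀ k z κ : 𝔸ˣ) : 𝔸) * (((vcov L U₀ (expCfg B) k (z + e κ))⁻¹ : 𝔸ˣ) : 𝔸)
          * (((avgIter L U₀ k z κ)⁻¹ : 𝔸ˣ) : 𝔸)) := by
    rw [val_avgIter_mul_eq]
    simp only [mul_assoc]
  have hR : ‖((avgIter L U₀ k z κ : 𝔸ˣ) : 𝔸) * (((vcov L U₀ (expCfg B) k (z + e κ))⁻¹ : 𝔸ˣ) : 𝔸)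
        * (((avgIter L U₀ k z κ)⁻¹ : 𝔸ˣ) : 𝔸) - 1‖ ≤ 64 * d * x :=
    (norm_units_conj_sub_one_le (hV z κ) _).trans (hv'.trans h64)
  have hvx : ‖((vcov L U₀ (expCfg B) k z : 𝔸ˣ) : 𝔸) - 1‖ ≤ 64 * d * x := hv.trans h64
  rw [h159]
  refine (mul_sub_one_norm_le _ _).trans ?_
  have hin := mul_sub_one_norm_le ((vcov L U₀ (expCfg B) k z : 𝔸ˣ) : 𝔸) ((dbavgCovIter L U₀ (expCfg B) k z κ : 𝔸ˣ) : 𝔸)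
  -- arithmetic: (1+64dx)(1+4x)(1+64dx) − 1 ≤ 136(d+1)x under 2048dx ≤ 1, 128x ≤ 1
  have hA : 1 + ‖((vcov L U₀ (expCfg B) k z : 𝔸ˣ) : 𝔸) * ((dbavgCovIter L U₀ (expCfg B) k z κ : 𝔸ˣ) : 𝔸) - 1‖
      ≤ (1 + 64 * d * x) * (1 + 4 * x) := by
    have := mul_le_mul (add_le_add_left hvx 1) (add_le_add_left hWb 1) (by positivity) (by positivity)
    linarith
  have hBd : 1 + ‖((avgIter L U₀ k z κ : 𝔸ˣ) : 𝔸) * (((vcov L U₀ (expCfg B) k (z + e κ))⁻¹ : 𝔸ˣ) : 𝔸)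
        * (((avgIter L U₀ k z κ)⁻¹ : 𝔸ˣ) : 𝔸) - 1‖ ≤ 1 + 64 * d * x := by linarith
  have hdx : 64 * (d : ℝ) * x ≤ 1 / 32 := by rw [hx]; nlinarith
  have h4x : 4 * x ≤ 1 / 32 := by rw [hx]; nlinarith
  calc _ ≤ (1 + 64 * d * x) * (1 + 4 * x) * (1 + 64 * d * x) - 1 := by
        nlinarith [mul_le_mul hA hBd (by positivity) (by positivity)]
    _ ≤ 136 * ((d : ℝ) + 1) * x := by nlinarith [mul_nonneg (mul_nonneg hd hx0) hx0, mul_nonneg hd hx0]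

end Tower

end Literature.MathematicalPhysics.QuantumFieldTheory.Balaban1983to89.B7Eq162General

end
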